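/-
Copyright (c) 2026. All rights reserved.
Released under Apache 2.0 license as described in the file LICENSE.
Authors: abc-iut cell, seat abc-iut-L6-t6 (the last sentence of [IUTchIII] Example 3.6 (iii), part 3:
rigidity on REALIFICATIONS at the number-field model; proof-only).
-/
import Literature.IUT.LogThetaLattice.GlobalFrobenioidModelsUnitTwist
import Literature.IUT.LogThetaLattice.GlobalFrobenioidModelsPlacesUnits
import Literature.IUT.LogThetaLattice.GlobalLGPFrobenioidsRealifiedModel
import Literature.AlgebraicGeometry.Frobenioids.ArithmeticDivisorsUnits
import HarnessLib

/-!
# [IUTchIII] Example 3.6 (iii), last sentence — the REALIFICATION clause: the unit twists of `(†𝓕⊛_𝔪𝔬𝔡)_α`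
# die in `(†𝓕⊛ℝ_𝔪𝔬𝔡)_α` (proof-only companion of `GlobalFrobenioidModelsUnitTwist.lean`)

S. Mochizuki, *Inter-universal Teichmüller Theory III*, kurims manuscript (May 2020), Example 3.6 (iii),
p. 108 (read on this seat's render `paper:url-4b091feeb646` p. 108) [claim key Mochizuki2012, status disputed
(D-0012)]: "… although the above isomorphism of Frobenioids is not necessarily determined by the condition that
it induce the identity morphism on `F^×_mod`, the induced isomorphism between the respective perfections [hence
also on realifications] of `𝓕⊛_𝔪𝔬𝔡`, `𝓕⊛_MOD` is completely determined by this condition."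

`GlobalFrobenioidModelsUnitTwist.lean` (this seat) exhibits the indeterminacy over the tree's own model of
Ex. 3.6: for `u ∈ F^×_mod` with `β_v(u) = 0` at every `v`, the unit twist `Ψ_u = FrakCat.unitTwist u hu` of
`𝓕⊛_𝔪𝔬𝔡` is the identity on objects and linear morphisms (so "induces the identity on `F^×_mod`"), is compatible
with the Frobenioid structure on the nose, yet `Ψ_u ≠ 𝟭` for `u ≠ 1` (`unitTwist_ne_id`); the perfection half
of the sentence is that file's companion `…PerfectionRigidity.lean`.  THIS FILE proves the bracketed
REALIFICATION clause at the NUMBER-FIELD MODEL, where the realification of [FrdI] Prop. 5.3 is a tree object: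
abc-iut-w5-d153's `Prop37.FrakRlfCat F` (the model Frobenioid of `(Φ^rlf, ℝ · Φ^birat)` over the one-morphism
base) with THE realification functor `Prop37.realification F : Prop37.Ffrak F ⥤ FrakRlfCat F`
(`GlobalLGPFrobenioidsRealifiedModel.lean`) on abc-iut-w4-d005's INTEGRAL datum of Ex. 3.6 (`Γ_v = ℤ` at finite,
`ℝ` at archimedean places, `β_v = ord_v` / `−log|·|_v`: `Prop37.Ffrak F`, `GlobalLGPFrobenioidsModFrak.lean`), which
factors as the `F^×`-enlargement `Prop37.realify F` (rational functions kept) followed by the quotient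
`Prop37.toRlf F` (`(n, f) ↦ (n, Div f)`):

* `Prop37.unitTwist_comp_toRlf` — at the `ℝ`-enlargement: `Ψ_u ⋙ toRlf = toRlf` ON THE NOSE (`Div(u) = 0`);
* `Prop37.unitTwist_comp_realify` — the enlargement still SEES the twist: `Ψ_u ⋙ realify = realify ⋙ Ψ_u`
  (`realify` is faithful, abc-iut-w4-d005 `realify_faithful`, and `Ψ_u ≠ 𝟭` there too);
* **`Prop37.unitTwist_comp_realification`** — `Ψ_u ⋙ realification F = realification F` ON THE NOSE: every one of
  the pairwise distinct unit-twisted identifications becomes THE SAME functor after realification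
  (`Prop37.realification_unitTwist_eq_unitTwist`), abc-iut-w5-d153's `toRlf_map_negOne` (`(1, −1) ↦ 𝟙`) being the
  `u = −1`, degree-`1` instance;
* `Prop37.beta_eq_zero_iff_isOfFinOrder` — WHICH twists exist at the integral datum: `β_v(u) = 0` for every
  place `v` iff `u` is a root of unity ([FrdI] Ex. 6.3 "`O^×(A) = μ(L)`", abc-iut-L1's
  `principalArithDivisor_eq_zero_iff`, through abc-iut-w4-d005's divisor dictionary `frakObjEquiv_betaDiv`; the
  counterpart for abc-iut-L6-d1's real datum is this seat's `isOfFinOrder_of_betaModel_eq_zero`,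
  `GlobalFrobenioidModelsPlacesUnits.lean`) — so the indeterminacy before perfection/realification is exactly
  the torsion `μ(F_mod)`, never trivial (`−1`: `Prop37.beta_negOne`, `Prop37.unitTwist_negOne_ne_id`), and
  killed by `Div : F^× → ℝ · Φ^birat`;
* `Prop37.ex36iii_realification_determined` — the packaged clause.

READING (disclosed, as in the companion). "Determined" is read ON THE NOSE for functors: under [IUTchI] §0's
convention "isomorphism = isomorphism class of equivalences" all `Ψ_u` already define the identity class
(`unitTwistIso`); what realification adds is equality of functors.  The realification of the torsor version
`𝓕⊛_MOD` is not a separate tree object: [FrdI] Prop. 5.3 builds `C^rlf` from the divisor monoid and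
`ℝ · Φ^birat` alone, data which `toMOD` / `toFrak` identify on the nose (`toMODCompStructure`,
`GlobalFrobenioidModelsIdentification.lean`), so the statement is made on the `𝔪𝔬𝔡` side, through which every
identification `Ψ_u ⋙ toMOD` of the companion factors.  Theorems only; no new definitions.
HONEST FRAMING: elementary algebra of the tree's own model of Ex. 3.6 plus Kronecker's theorem on units;
nothing here bears on [IUTchIII] Cor. 3.12; typed ≠ endorsed.
-/

namespace Literature.IUT.LogThetaLattice

namespace Prop37

open CategoryTheory NumberField IsDedekindDomain GlobalFrobenioidModels GlobalFrobenioidModels.FrakCat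
open Literature.AlgebraicGeometry.Frobenioids (Places)

variable (F : Type) [Field F] [NumberField F]

/-! ### Principal real families of global units vanish -/

/-- `Div(f⁻¹) = −Div(f)` in `ℝ · Φ^birat`. [cite: MochizukiFrdI2008, Thm. 5.2 p.100] -/
theorem prinFamily_inv (f : Fˣ) : prinFamily F f⁻¹ = -prinFamily F f := by
  rw [eq_neg_iff_add_eq_zero, add_comm, ← prinFamily_mul, mul_inv_cancel, prinFamily_one]

/-- Conjugating the rational function by a unit of trivial divisor does not change its divisor:
`Div(u · f · u^{−n}) = Div(f)` when `Div(u) = 0`. [cite: MochizukiFrdI2008, Prop. 5.3 p.103] -/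
theorem prinFamily_conj_eq (u f : Fˣ) (n : ℕ) (hu0 : prinFamily F u = 0) :
    prinFamily F (u * f * u⁻¹ ^ n) = prinFamily F f := by
  rw [prinFamily_mul, prinFamily_mul, prinFamily_pow, prinFamily_inv, hu0, neg_zero, smul_zero, zero_add,
    add_zero]

/-- A unit at every place of abc-iut-L6-d1's real datum has principal real family `Div(u) = 0`.
([IUTchIII] Ex 3.6 (iii) p.108) [claim: Mochizuki2012, status: disputed] -/
theorem prinFamily_eq_zero_of_betaModel (u : Fˣ)
    (hu : ∀ p : ModelPlaces F, betaModel p (Additive.ofMul u) = 0) : prinFamily F u = 0 :=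
  FrakObj.ext_cls (funext fun p => by
    show betaModel p (Additive.ofMul u) = (0 : ModelFrakObj F).cls p
    rw [FrakObj.cls_zero]
    exact hu p)

/-! ### At the `ℝ`-enlargement: `toRlf` kills every unit twist -/

section Enlargement

variable (u : Fˣ) (hu : ∀ p : ModelPlaces F, betaModel p (Additive.ofMul u) = 0)
include hu

/-- `toRlf (Ψ_u φ) = toRlf φ`: the twisted rational function `u · f · u^{−n}` has the divisor of `f`.
([IUTchIII] Ex 3.6 (iii) p.108) [claim: Mochizuki2012, status: disputed] -/
theorem toRlf_map_unitTwist {X Y : FrakCat F (ModelPlaces F) (fun _ => ℝ) nonnegModel betaModel}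
    (φ : X ⟶ Y) : (toRlf F).map ((unitTwist u hu).map φ) = (toRlf F).map φ :=
  FrakRlfCat.hom_ext (by rw [deg_toRlf_map, deg_toRlf_map, deg_unitTwist_map])
    (by rw [fn_toRlf_map, fn_toRlf_map, fn_unitTwist_map,
      prinFamily_conj_eq F u _ _ (prinFamily_eq_zero_of_betaModel F u hu)])

/-- **`Ψ_u ⋙ toRlf = toRlf` ON THE NOSE** (at the `ℝ`-enlargement of `(†𝓕⊛_𝔪𝔬𝔡)_α`).
([IUTchIII] Ex 3.6 (iii) p.108) [claim: Mochizuki2012, status: disputed] -/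
theorem unitTwist_comp_toRlf : unitTwist u hu ⋙ toRlf F = toRlf F :=
  Functor.hext (fun _ => rfl) fun _ _ φ => heq_of_eq (toRlf_map_unitTwist F u hu φ)

end Enlargement

/-! ### At the integral datum: the realification functor kills every unit twist -/

section Integral

variable (u : Fˣ) (hu : ∀ p : Places F, beta F p (Additive.ofMul u) = 0)
include hu

/-- A unit at every place of the integral datum is a unit at every place of the real datum (`ord_v` cast to
`ℝ`, `−log|·|_v` unchanged). ([IUTchIII] Ex 3.6 (iii) p.108) [claim: Mochizuki2012, status: disputed] -/
theorem betaModel_eq_zero_of_beta : ∀ p : ModelPlaces F, betaModel p (Additive.ofMul u) = 0 := by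
  rintro (v | w)
  · rw [betaModel_inl_eq_cast_beta]
    have h : (beta F (.inr (FinitePlace.mk v)) (Additive.ofMul u) : ℤ) = 0 := hu _
    rw [h, Int.cast_zero]
  · rw [betaModel_inr_eq_beta]
    exact hu _

/-- `realification (Ψ_u φ) = realification φ`. ([IUTchIII] Ex 3.6 (iii) p.108) [claim: Mochizuki2012, status: disputed] -/
theorem realification_map_unitTwist {X Y : Ffrak F} (φ : X ⟶ Y) :
    (realification F).map ((unitTwist u hu).map φ) = (realification F).map φ :=
  FrakRlfCat.hom_ext (by
      show FrakCat.deg ((unitTwist u hu).map φ) = FrakCat.deg φ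
      exact deg_unitTwist_map u hu φ)
    (by rw [fn_realification_map, fn_realification_map, fn_unitTwist_map,
      prinFamily_conj_eq F u _ _ (prinFamily_eq_zero_of_betaModel F u (betaModel_eq_zero_of_beta F u hu))])

/-- **[IUTchIII] Ex. 3.6 (iii), realification clause: `Ψ_u ⋙ realification = realification` ON THE NOSE.**
The unit twist `Ψ_u` of `(†𝓕⊛_𝔪𝔬𝔡)_α` — an isomorphism of Frobenioids inducing the identity on `F^×_mod`, `≠ 𝟭`
for `u ≠ 1` — induces the identity on THE realification `(†𝓕⊛ℝ_𝔪𝔬𝔡)_α` ([FrdI] Prop. 5.3: rational functions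
`ℝ · Φ^birat`, where `Div(u) = 0`). ([IUTchIII] Ex 3.6 (iii) p.108) [claim: Mochizuki2012, status: disputed] -/
theorem unitTwist_comp_realification : unitTwist u hu ⋙ realification F = realification F :=
  Functor.hext (fun _ => rfl) fun _ _ φ => heq_of_eq (realification_map_unitTwist F u hu φ)

/-- `realify (Ψ_u φ) = Ψ_u (realify φ)`: the enlargement carries the twist along (same degree, same rational
function `u · f · u^{−n}`). ([IUTchIII] Ex 3.6 (iii) p.108) [claim: Mochizuki2012, status: disputed] -/
theorem realify_map_unitTwist {X Y : Ffrak F} (φ : X ⟶ Y) :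
    (realify F).map ((unitTwist u hu).map φ) =
      (unitTwist u (betaModel_eq_zero_of_beta F u hu)).map ((realify F).map φ) :=
  FrakCat.hom_ext (by rw [deg_realify_map, deg_unitTwist_map, deg_unitTwist_map, deg_realify_map])
    (by rw [fn_realify_map, fn_unitTwist_map, fn_unitTwist_map, fn_realify_map, deg_realify_map])

/-- The `F^×`-ENLARGEMENT still sees the twist: `Ψ_u ⋙ realify = realify ⋙ Ψ_u` (same `u`, real datum) — the
twist dies exactly at the quotient `toRlf`, not at the change of value groups `ℤ ↪ ℝ`.
([IUTchIII] Ex 3.6 (iii) p.108) [claim: Mochizuki2012, status: disputed] -/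
theorem unitTwist_comp_realify :
    unitTwist u hu ⋙ realify F = realify F ⋙ unitTwist u (betaModel_eq_zero_of_beta F u hu) :=
  Functor.hext (fun _ => rfl) fun _ _ φ => heq_of_eq (realify_map_unitTwist F u hu φ)

/-- All unit-twisted copies of the realification functor coincide: `Ψ_u ⋙ rlf = Ψ_{u′} ⋙ rlf`.
([IUTchIII] Ex 3.6 (iii) p.108) [claim: Mochizuki2012, status: disputed] -/
theorem realification_unitTwist_eq_unitTwist (u' : Fˣ) (hu' : ∀ p : Places F, beta F p (Additive.ofMul u') = 0) :
    unitTwist u hu ⋙ realification F = unitTwist u' hu' ⋙ realification F := by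
  rw [unitTwist_comp_realification F u hu, unitTwist_comp_realification F u' hu']

end Integral

/-! ### Which twists exist at the model: exactly the roots of unity (Kronecker) -/

/-- The principal integral family `(β_v(u))_v` vanishes iff `β_v(u) = 0` at every place.
([IUTchIII] Ex 3.6 (ii) p.107) [claim: Mochizuki2012, status: disputed] -/
theorem betaDiv_eq_zero_iff (u : Fˣ) :
    Multiplicative.toAdd (betaDiv (modelHyps F) u) = 0 ↔ ∀ p : Places F, beta F p (Additive.ofMul u) = 0 := by
  constructor
  · intro h p
    have h' := congrArg (fun J : FrakObj (Places F) (Gamma F) => J.cls p) h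
    simpa only [cls_betaDiv, FrakObj.cls_zero] using h'
  · intro h
    exact FrakObj.ext_cls (funext fun p => by rw [cls_betaDiv, FrakObj.cls_zero]; exact h p)

/-- **The units invisible at every place are exactly the roots of unity** ([FrdI] Ex. 6.3 "`O^×(A) = μ(L)`",
Kronecker): `β_v(u) = 0` for every `v ∈ 𝕍` iff `u ∈ F^×_mod` has finite order — through abc-iut-w4-d005's
dictionary `frakObjEquiv_betaDiv` with the arithmetic divisors of [FrdI] Ex. 6.3 and abc-iut-L1's
`principalArithDivisor_eq_zero_iff`. [cite: MochizukiFrdI2008, Ex. 6.3 p.113] -/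
theorem beta_eq_zero_iff_isOfFinOrder (u : Fˣ) :
    (∀ p : Places F, beta F p (Additive.ofMul u) = 0) ↔ IsOfFinOrder u := by
  rw [← betaDiv_eq_zero_iff, ← Literature.AlgebraicGeometry.Frobenioids.principalArithDivisor_eq_zero_iff,
    ← frakObjEquiv_betaDiv]
  exact (frakObjEquiv F).map_eq_zero_iff.symm

/-- `−1` is a unit at every place of the integral datum. ([IUTchIII] Ex 3.6 (iii) p.108) [claim: Mochizuki2012, status: disputed] -/
theorem beta_negOne : ∀ p : Places F, beta F p (Additive.ofMul (-1 : Fˣ)) = 0 :=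
  (beta_eq_zero_iff_isOfFinOrder F (-1)).mpr isOfFinOrder_neg_one_units

/-- The unit twist `Ψ_{−1}` of `(†𝓕⊛_𝔪𝔬𝔡)_α` at the number-field model is NOT the identity functor (`−1 ≠ 1` in a
number field, `neg_one_ne_one_units`; part 1's `unitTwist_ne_id`). ([IUTchIII] Ex 3.6 (iii) p.108) [claim: Mochizuki2012, status: disputed] -/
theorem unitTwist_negOne_ne_id : unitTwist (-1 : Fˣ) (beta_negOne F) ≠ 𝟭 (Ffrak F) :=
  unitTwist_ne_id (-1) (beta_negOne F) neg_one_ne_one_units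

/-- **[IUTchIII] Ex. 3.6 (iii), last sentence, realification clause, at the number-field model (packaged).**
The isomorphisms of Frobenioids `Ψ_u : (†𝓕⊛_𝔪𝔬𝔡)_α ⥲ (†𝓕⊛_𝔪𝔬𝔡)_α` inducing the identity on `F^×_mod`, indexed by the
roots of unity `u ∈ μ(F_mod)` (`beta_eq_zero_iff_isOfFinOrder`), are NOT all equal (`Ψ_{−1} ≠ 𝟭 = Ψ_1`), but
they all induce THE SAME functor to the realification `(†𝓕⊛ℝ_𝔪𝔬𝔡)_α`: `Ψ_u ⋙ realification = realification`.
([IUTchIII] Ex 3.6 (iii) p.108) [claim: Mochizuki2012, status: disputed] -/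
theorem ex36iii_realification_determined :
    (∃ (u : Fˣ) (hu : ∀ p : Places F, beta F p (Additive.ofMul u) = 0), unitTwist u hu ≠ 𝟭 (Ffrak F)) ∧
      ∀ (u : Fˣ) (hu : ∀ p : Places F, beta F p (Additive.ofMul u) = 0),
        IsOfFinOrder u ∧ unitTwist u hu ⋙ realification F = realification F :=
  ⟨⟨-1, beta_negOne F, unitTwist_negOne_ne_id F⟩, fun u hu =>
    ⟨(beta_eq_zero_iff_isOfFinOrder F u).mp hu, unitTwist_comp_realification F u hu⟩⟩

end Prop37

end Literature.IUT.LogThetaLattice
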